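import Summits.MatrixMultiplication.MatrixMultiplication.Theses.MarginalColumns
import Summits.MatrixMultiplication.MatrixMultiplication.Theorems.SecondColumnDominates.Negative.LoadBearing
import Literature.Computability.AlgebraicComplexity.BorderRankMatMulTwoSeven

/-!
# `TwoTowerAffine` (route `MarginalColumns`, support item stmt-MatrixMultiplication-16316)

`SecondColumnDominates → ∀ w ≥ 1, R̲⟨2,2,w⟩ ≤ 3w + 1`: the `n = 2` slice of the crux D is
Landsberg's expected law for the `(2,2)` tower (Landsberg 2017 §4.8.2; Landsberg–Ryder 2017 §3;
Conner–Harper–Landsberg 2023 p. 4 "we expect equality to hold for all `n`"). From D at `n = 2`,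
`T (w+1) + T 1 ≤ T w + T 2` with `T 1 = R̲⟨2,2,1⟩ = 4` (`Negative.algBorderRank_matMulTensor_sq_one`)
and `T 2 = R̲⟨2,2,2⟩ ≤ 7` (Strassen, `algBorderRank_matMulTensor_two_le_seven`, PROVED in tree),
by induction on `w ≥ 1`.

Landed by the line lead of crux stmt-MatrixMultiplication-16310 (line `Sketch`).
-/

set_option linter.dupNamespace false

noncomputable section

namespace Summit.MatrixMultiplication.MatrixMultiplication.Theorems

open Literature.Computability.AlgebraicComplexity
open Summit.MatrixMultiplication.MatrixMultiplication.Theses.MarginalColumns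

/-- **D ⇒ `R̲⟨2,2,w⟩ ≤ 3w + 1` for all `w ≥ 1`** (induction on `w`; base `R̲⟨2,2,1⟩ = 4`, step
`T (w+1) ≤ T w + 7 − 4` from D and Strassen's `R̲⟨2,2,2⟩ ≤ 7`).
[cite: LandsbergGCT2017, §4.8.2 (p. 109)] [cite: LandsbergRyder2015, §3 Prop. 3.1–3.2] -/
theorem twoTowerAffine_proof : TwoTowerAffine := by
  unfold TwoTowerAffine SecondColumnDominates
  intro hD w hw
  have h4 : algBorderRank (matMulTensor ℂ 2 2 1) = 2 * 2 :=
    SecondColumnDominates.Negative.algBorderRank_matMulTensor_sq_one 2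
  have h7 : algBorderRank (matMulTensor ℂ 2 2 2) ≤ 7 := algBorderRank_matMulTensor_two_le_seven ℂ
  induction w, hw using Nat.le_induction with
  | base => omega
  | succ w hw ih =>
      have hd := hD 2 w (by norm_num) hw
      omega

end Summit.MatrixMultiplication.MatrixMultiplication.Theorems

end
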